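import Summits.NavierStokesRegularity.NavierStokesRegularity.Theorems.LerayQuarterDissipationFiniteDissipationLiouvilleSliceContinuity
import Summits.NavierStokesRegularity.NavierStokesRegularity.Theorems.LerayQuarterDissipationFiniteDissipationLiouvilleDssNearOne
import Summits.NavierStokesRegularity.NavierStokesRegularity.Theorems.CorkscrewDynamoCorkscrewProfileRdssTunedCompactness
import HarnessLib

/-!
# `FiniteDissipationLiouville`, line `birth`: the DSS leaf cut ON THE PAST (repair of the
# DSS / wandering dichotomy)

Crux `Summit.NavierStokesRegularity.NavierStokesRegularity.Theses.LerayQuarterDissipation.FiniteDissipationLiouville`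
(item stmt-NavierStokesRegularity-22144), route LerayQuarterDissipation, line `birth`, lead prover
ns-lqd-lead g2. NS regularity is NOT proved by anything here; no summit is.

The line's skeleton (v3) cut the recurrent leaf by the tree's TIME-GLOBAL predicate
`IsDiscretelySelfSimilar c w : nsRescale c w = w` (an identity at all `t ∈ ℝ`), while the class
`IsTypeIAncientMild`, the dissipation law, the recurrence clause and the apex clause read `w` only
at `t < 0`; the standing disprover showed (`…Negative.dssStub_of_wanderingStub`, p581758) that the
"non-DSS" hypothesis of the wandering stub is therefore content-free (tamper the future). The
repair is to cut by **discrete self-similarity on the past**,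

  `PastDSS c w :≡ ∀ t < 0, ∀ x, c • w (c ^ 2 * t) (c • x) = w t x`

(written inline everywhere; no definition is introduced). This file transfers the landed DSS-leaf
results to the past-DSS hypothesis:

* the KNSS class only reads negative times (tree: `CorkscrewProfile.Birth.isTypeIAncientMild_congr_neg`,
  imported);
* `exists_dss_extension_of_pastDSS` — a past-DSS field agrees on `t < 0` with a time-globally
  `c`-DSS field (cut the future off to `0`);
* `pastDssExclusion_of_typeIDSSLiouville` — the repaired DSS stub of the skeleton follows from the
  catalogued wall `∀ c > 1, Literature.Analysis.FluidPDE.TypeIDSSLiouville c` (Bradshaw–Tsai 2017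
  OP 5.1), through the landed `stub_dssExclusion_of_typeIDSSLiouville` (p583968);
* `exists_pastDss_threshold` — the near-one corner unconditionally (Chae–Wolf 2017 Thms 1.1/1.3 as
  landed in `exists_dss_threshold`, p584562): every past-`c`-DSS member has a `c₁ > 1` with
  `c < c₁ ⇒ w ≡ 0` on the past.
-/

noncomputable section

open MeasureTheory Set Function Filter
open scoped Topology ENNReal

namespace Summit.NavierStokesRegularity.NavierStokesRegularity.Theorems.FiniteDissipationLiouville.Birth

open Literature.Analysis.FluidPDE

-- the problem-side namespace duplicates `NavierStokesRegularity` by design (summit = problem)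
set_option linter.dupNamespace false

/-- **Past-DSS fields extend to time-global DSS fields**: if `c • w (c²t) (c•x) = w t x` for all
`t < 0` (`0 < c`), then the field equal to `w` on `t < 0` and to `0` on `t ≥ 0` is `c`-discretely
self-similar in the tree's time-global sense and has the same past. -/
theorem exists_dss_extension_of_pastDSS {c : ℝ} (hc : 0 < c)
    {w : ℝ → EuclideanSpace ℝ (Fin 3) → EuclideanSpace ℝ (Fin 3)}
    (hpast : ∀ t : ℝ, t < 0 → ∀ x, c • w (c ^ 2 * t) (c • x) = w t x) :
    ∃ w' : ℝ → EuclideanSpace ℝ (Fin 3) → EuclideanSpace ℝ (Fin 3),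
      IsDiscretelySelfSimilar c w' ∧ ∀ t < 0, w' t = w t := by
  refine ⟨fun t x => if t < 0 then w t x else 0, ?_, fun t ht => funext fun x => by simp [ht]⟩
  funext t x
  rw [nsRescale_apply]
  by_cases ht : t < 0
  · have hct : c ^ 2 * t < 0 := mul_neg_of_pos_of_neg (by positivity) ht
    simp only [ht, hct, if_true, hpast t ht x]
  · have hct : ¬ c ^ 2 * t < 0 := fun h' => ht (by
      by_contra h''
      exact absurd h' (not_lt.2 (mul_nonneg (sq_nonneg c) (not_lt.1 h''))))
    simp only [ht, hct, if_false, smul_zero]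

/-- **The repaired DSS stub from the wall.** If the catalogued Type-I `λ`-DSS Liouville statement
`Literature.Analysis.FluidPDE.TypeIDSSLiouville c` holds for every `c > 1` (Bradshaw–Tsai 2017,
Open Problem 5.1 — OPEN), then every member of the finite-dissipation Type-I ancient mild stratum
which is discretely self-similar ON THE PAST with some factor `c > 1` is bounded on some backward
cylinder at the origin. (Extend to a time-global DSS field with the same past, transfer class, law
and apex clause — all read `t < 0` only — and apply `stub_dssExclusion_of_typeIDSSLiouville`.) -/
theorem pastDssExclusion_of_typeIDSSLiouville
    (hwall : ∀ c : ℝ, 1 < c → TypeIDSSLiouville c) :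
    ∀ (C K c : ℝ) (w : ℝ → EuclideanSpace ℝ (Fin 3) → EuclideanSpace ℝ (Fin 3)), 1 < c →
      IsTypeIAncientMild C w →
      (∀ s : ℝ, s < 0 → ∫⁻ x, ‖fderiv ℝ (w s) x‖ₑ ^ 2 ≤ ENNReal.ofReal (K / Real.sqrt (-s))) →
      (∀ t : ℝ, t < 0 → ∀ x, c • w (c ^ 2 * t) (c • x) = w t x) →
      ¬ (∀ r > 0, ∀ M : ℝ, ∃ t ∈ Set.Ioo (-(r ^ 2)) (0 : ℝ),
          ∃ x ∈ Metric.ball (0 : EuclideanSpace ℝ (Fin 3)) r, M < ‖w t x‖) := by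
  intro C K c w hc hw hD hpast hsing
  obtain ⟨w', hdss', hp⟩ := exists_dss_extension_of_pastDSS (one_pos.trans hc) hpast
  have hw' : IsTypeIAncientMild C w' := CorkscrewProfile.Birth.isTypeIAncientMild_congr_neg hw hp
  have hD' : ∀ s : ℝ, s < 0 →
      ∫⁻ x, ‖fderiv ℝ (w' s) x‖ₑ ^ 2 ≤ ENNReal.ofReal (K / Real.sqrt (-s)) :=
    fun s hs => by rw [hp s hs]; exact hD s hs
  have hsing' : ∀ r > 0, ∀ M : ℝ, ∃ t ∈ Set.Ioo (-(r ^ 2)) (0 : ℝ),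
      ∃ x ∈ Metric.ball (0 : EuclideanSpace ℝ (Fin 3)) r, M < ‖w' t x‖ := by
    intro r hr M
    obtain ⟨t, ht, x, hx, hM⟩ := hsing r hr M
    exact ⟨t, ht, x, hx, by rw [hp t ht.2]; exact hM⟩
  exact stub_dssExclusion_of_typeIDSSLiouville hwall C K c w' hc hw' hD' hdss' hsing'

/-- **The near-one corner of the repaired DSS stub, unconditionally** (Chae–Wolf 2017 Thm 1.1 with
`p = 6` and Thm 1.3, as landed in `exists_dss_threshold`): every member of the stratum that is
`c`-DSS on the past, `1 < c`, has a threshold `c₁ > 1` (depending on the member through its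
envelope constant) such that `c < c₁` forces `w ≡ 0` on the past. -/
theorem exists_pastDss_threshold {C K c : ℝ}
    {w : ℝ → EuclideanSpace ℝ (Fin 3) → EuclideanSpace ℝ (Fin 3)} (hw : IsTypeIAncientMild C w)
    (hD : ∀ s : ℝ, s < 0 → ∫⁻ x, ‖fderiv ℝ (w s) x‖ₑ ^ 2 ≤ ENNReal.ofReal (K / Real.sqrt (-s)))
    (hc : 1 < c) (hpast : ∀ t : ℝ, t < 0 → ∀ x, c • w (c ^ 2 * t) (c • x) = w t x) :
    ∃ c₁ : ℝ, 1 < c₁ ∧ (c < c₁ → ∀ t < 0, ∀ x, w t x = 0) := by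
  obtain ⟨w', hdss', hp⟩ := exists_dss_extension_of_pastDSS (one_pos.trans hc) hpast
  have hw' : IsTypeIAncientMild C w' := CorkscrewProfile.Birth.isTypeIAncientMild_congr_neg hw hp
  have hD' : ∀ s : ℝ, s < 0 →
      ∫⁻ x, ‖fderiv ℝ (w' s) x‖ₑ ^ 2 ≤ ENNReal.ofReal (K / Real.sqrt (-s)) :=
    fun s hs => by rw [hp s hs]; exact hD s hs
  obtain ⟨c₁, hc₁, H⟩ := exists_dss_threshold hw' hD' hc hdss'
  exact ⟨c₁, hc₁, fun hcc t ht x => by rw [← congrFun (hp t ht) x]; exact H hcc t ht x⟩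

end Summit.NavierStokesRegularity.NavierStokesRegularity.Theorems.FiniteDissipationLiouville.Birth

end
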